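import Literature.Topology.FourManifolds.GompfShearModel
import HarnessLib

/-!
# The section of the shear model over the punctured torus (Gompf's surface `F′`)

The straightened Cappell–Shaneson model `modelSphere` (`GompfShearModel.lean`) is surgery on the
section circle of the mapping torus of `𝔏 (z₁, z₂, z₃) = (z₁, z₂, z₃ z₁ χ-shear)`; on the slab
`|y| ≤ 1` (`z₂ = e^{iy}`) the last factor is an `𝕊¹`-bundle over the `(n, s)`-torus whose
clutching function along the seam `s ∈ ℤ` is the degree-one map `z₁ ↦ z₁ · shearFactor 1 z₁ 1`.
Gompf's punctured torus `F′` and disc `D` (*More Cappell–Shaneson spheres are standard*, Algebr.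
Geom. Topol. 10 (2010), proof of Thm 2.1) are realised in the model as the graph of a section
`σ` of this bundle over the torus punctured at one point `q₀`; this file constructs `σ`.

* `Literature.Topology.FourManifolds.argCut c` — the argument with branch cut at angle `c`, and the
  **real lift of the seam function** `Literature.Topology.FourManifolds.seamLift c z = 2π λ(argCut c z - 1)`
  with `Circle.exp (seamLift c z) = z * shearFactor 1 z 1` (`circleExp_seamLift`) and its jump of
  `2π` placed at the cut `c` (we take `c = n_j ∈ (-π, 0)`, just outside the cap).
* `Literature.Topology.FourManifolds.sStep δ` — the step in the base direction across
  `s ∈ (3/4 - δ, 3/4 + δ)`; the **far section** `σ₀ = sStep(s) · seamLift(z₁)`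
  (`Literature.Topology.FourManifolds.sigmaFar`), which satisfies the seam condition and is smooth
  off the slit `{z₁ = e^{ic}} × [3/4 - δ, 3/4 + δ]` as a circle-valued map
  (`contMDiffAt_sigmaFarC`).
* Near the puncture, in the cap chart `d` (`FishtailCoordinates.lean`; here only `arg d` and
  `re d` are used) with `d₀ = -i t_j`: the branch `Literature.Topology.FourManifolds.thetaHat` of
  the angle about `d₀` cut along the outward ray, the correction
  `Literature.Topology.FourManifolds.seamCorr = 2π g₁ (sStep - g₂) - thetaHat` (an instance of
  `Literature.Topology.FourManifolds.seamCorrG` for a general step `S`) which is *smooth on a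
  punctured neighbourhood off the slit* (`contDiffAt_seamCorrG`, `contDiffAt_seamCorr`) although
  each term jumps, and the
  identities `e^{i thetaHat(v)} = v/|v|`, `e^{i seamCorr} · (v/|v|) = e^{2πi g₁ sStep}` that make
  `σ = thetaHat + β · seamCorr` interpolate between the polar angle about the puncture (winding
  `+1`: the cap chart reverses the orientation of the `(n, s)`-coordinates) and `σ₀`.
* `Literature.Topology.FourManifolds.sigmaOutC` — the far section read on the whole cap disc as a
  circle-valued map `e^{2πi g₁ sStep(s(d))}`, equal to `1` above the level `im d = -t_j cos 2πδ`
  (`sigmaOutC_eq_one_of_im_gt`: the slit directions lie deep in the lower half-plane) and smooth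
  off the slit (`contMDiffAt_sigmaOutC`); `Literature.Topology.FourManifolds.unitC` (`v/|v|` as a
  point of the circle, smooth off `0`); and the assembled **section on the cap disc**
  `Literature.Topology.FourManifolds.sigmaCapC = (v/|v|) e^{iβ(|v|)F}` near the puncture, `= E`
  beyond, with `sigmaCapC_of_norm_le` (polar angle near the puncture), `sigmaCapC_of_le_norm` and
  smoothness off the puncture `contMDiffAt_sigmaCapC`.

Everything is proved; no named facts.

## References

* R. E. Gompf, *More Cappell–Shaneson spheres are standard*, Algebr. Geom. Topol. 10 (2010)
  1665–1681, proof of Thm 2.1 (`F`, `F′`, `C`, `D`). [GompfAGT2010]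
-/

noncomputable section

open scoped Manifold ContDiff Topology Real
open Set Function Complex Filter

namespace Literature.Topology.FourManifolds

/-! ### The argument with a prescribed cut and the real lift of the seam function -/

section Seam

/-- **The argument with branch cut at angle `c`**, valued in `(c, c + 2π]`. [folklore] -/
def argCut (c : ℝ) (z : Circle) : ℝ := arg ((z : ℂ) * exp (-((c + π : ℝ) : ℂ) * I)) + c + π

/-- `argCut c z ∈ (c, c + 2π]`. [folklore] -/
theorem argCut_mem (c : ℝ) (z : Circle) : argCut c z ∈ Ioc c (c + 2 * π) := by
  have h := Complex.arg_mem_Ioc ((z : ℂ) * exp (-((c + π : ℝ) : ℂ) * I))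
  rw [argCut]
  constructor <;> linarith [h.1, h.2]

/-- **`e^{i argCut} = z`.** [folklore] -/
theorem circleExp_argCut (c : ℝ) (z : Circle) : Circle.exp (argCut c z) = z := by
  apply Subtype.ext
  have hz : ‖(z : ℂ) * exp (-((c + π : ℝ) : ℂ) * I)‖ = 1 := by
    rw [norm_mul, Circle.norm_coe, one_mul, show (-((c + π : ℝ) : ℂ) * I) = ↑(-(c + π)) * I by
      push_cast; ring, norm_exp_ofReal_mul_I]
  have h := norm_mul_exp_arg_mul_I ((z : ℂ) * exp (-((c + π : ℝ) : ℂ) * I))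
  rw [hz, Complex.ofReal_one, one_mul] at h
  rw [Circle.coe_exp, argCut]
  push_cast
  rw [show ((arg ((z : ℂ) * exp (-((c : ℂ) + π) * I)) : ℂ) + c + π) * I =
      arg ((z : ℂ) * exp (-((c : ℂ) + π) * I)) * I + (c + π) * I by ring, Complex.exp_add]
  have h' : exp (↑(arg ((z : ℂ) * exp (-((c + π : ℝ) : ℂ) * I))) * I) =
      (z : ℂ) * exp (-((c + π : ℝ) : ℂ) * I) := h
  push_cast at h'
  rw [h', mul_assoc, ← Complex.exp_add, show (-((c : ℂ) + π) * I + (c + π) * I) = 0 by ring,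
    Complex.exp_zero, mul_one]

/-- **On the window `(c, c + 2π]` the cut argument of `e^{iθ}` is `θ`.** [folklore] -/
theorem argCut_exp {c θ : ℝ} (h1 : c < θ) (h2 : θ ≤ c + 2 * π) : argCut c (Circle.exp θ) = θ := by
  rw [argCut, Circle.coe_exp, ← Complex.exp_add,
    show (θ : ℂ) * I + -((c + π : ℝ) : ℂ) * I = ↑(θ - (c + π)) * I by push_cast; ring,
    arg_exp_mul_I, (toIocMod_eq_self _).2 ⟨by linarith, by linarith⟩]
  ring

/-- The cut argument is smooth off the cut point `e^{ic}`. [folklore] -/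
theorem contMDiffAt_argCut {c : ℝ} {z : Circle}
    (hz : (z : ℂ) * exp (-((c + π : ℝ) : ℂ) * I) ∈ slitPlane) :
    ContMDiffAt (𝓡 1) 𝓘(ℝ, ℝ) ∞ (argCut c) z := by
  have h1 : ContMDiffAt (𝓡 1) 𝓘(ℝ, ℂ) ∞ (fun w : Circle ↦ (w : ℂ) * exp (-((c + π : ℝ) : ℂ) * I)) z :=
    (contDiff_id.mul contDiff_const).contDiffAt.comp_contMDiffAt contMDiff_coe_circle.contMDiffAt
  exact (((contDiffAt_arg hz).comp_contMDiffAt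
    (f := fun w : Circle ↦ (w : ℂ) * exp (-((c + π : ℝ) : ℂ) * I)) h1).add contMDiffAt_const).add
    contMDiffAt_const

/-- Off the cut point the rotated point lies in the slit plane: if `z = e^{iθ}` with
`c < θ < c + 2π` then `z e^{-i(c+π)} = e^{i(θ - c - π)}` has argument in `(-π, π)`. [folklore] -/
theorem mul_exp_mem_slitPlane_of_mem_Ioo {c θ : ℝ} (h1 : c < θ) (h2 : θ < c + 2 * π) :
    (Circle.exp θ : ℂ) * exp (-((c + π : ℝ) : ℂ) * I) ∈ slitPlane := by
  rw [Circle.coe_exp, ← Complex.exp_add,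
    show (θ : ℂ) * I + -((c + π : ℝ) : ℂ) * I = ↑(θ - (c + π)) * I by push_cast; ring]
  refine mem_slitPlane_iff_arg.2 ⟨?_, Complex.exp_ne_zero _⟩
  rw [arg_exp_mul_I, (toIocMod_eq_self _).2 ⟨by linarith, by linarith⟩]
  linarith

/-- **The real lift of the seam function** with its jump at the cut `c`:
`G̃(z) = 2π λ(argCut c z - 1)`. [cite: GompfAGT2010, Thm 2.1 (proof: the monodromy ψ as a Dehn twist of the z-torus)] -/
def seamLift (c : ℝ) (z : Circle) : ℝ := 2 * π * Real.smoothTransition (argCut c z - 1)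

/-- On the window the lift is `2π λ(θ - 1)`. [folklore] -/
theorem seamLift_exp {c θ : ℝ} (h1 : c < θ) (h2 : θ ≤ c + 2 * π) :
    seamLift c (Circle.exp θ) = 2 * π * Real.smoothTransition (θ - 1) := by
  rw [seamLift, argCut_exp h1 h2]

/-- The lift is smooth off the cut point. [folklore] -/
theorem contMDiffAt_seamLift {c : ℝ} {z : Circle}
    (hz : (z : ℂ) * exp (-((c + π : ℝ) : ℂ) * I) ∈ slitPlane) :
    ContMDiffAt (𝓡 1) 𝓘(ℝ, ℝ) ∞ (seamLift c) z :=
  contMDiffAt_const.mul (Real.smoothTransition.contDiff.contDiffAt.comp_contMDiffAt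
    ((contMDiffAt_argCut hz).sub contMDiffAt_const))

/-- **The lift exponentiates to the seam function of the shear model**: for `-π < c < 1`,
`e^{i G̃(z)} = z · shearFactor 1 z 1` (the `y = 0` clutching map `z₃ ↦ z₃ z₁ χ-shear` of
`modelMonodromy`). [cite: GompfAGT2010, Thm 2.1 (proof)] -/
theorem circleExp_seamLift {c : ℝ} (hc1 : -π < c) (hc2 : c < 1) (z : Circle) :
    Circle.exp (seamLift c z) = z * shearFactor 1 z 1 := by
  have hπ := Real.pi_gt_three
  -- write `z = e^{iθ}` with `θ ∈ (-π, π]`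
  obtain ⟨θ, hθ, rfl⟩ : ∃ θ ∈ Ioc (-π) π, z = Circle.exp θ :=
    ⟨arg (z : ℂ), Complex.arg_mem_Ioc _, (Circle.exp_arg z).symm⟩
  have hθ1 := hθ.1
  have hθ2 := hθ.2
  have hsf : shearFactor 1 (Circle.exp θ) 1 = Circle.exp (-(sawArg (Circle.exp θ))) := by
    rw [shearFactor, nearBump_one]; ring_nf
  rw [hsf, ← Circle.exp_add]
  rcases lt_or_ge c θ with hcθ | hcθ
  · -- `θ` in the window: both sides are `2π λ(θ - 1)`
    rw [seamLift_exp hcθ (by linarith [hθ.2])]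
    rcases le_or_gt θ 1 with h1 | h1
    · rw [sawArg_exp hθ.1 h1, Real.smoothTransition.zero_of_nonpos (by linarith), mul_zero,
        add_neg_cancel]
    · -- `θ > 1`: `sawArg (e^{iθ}) = θ - gompfLift 1 2 θ`
      have hs : sawArg (Circle.exp θ) = θ - 2 * π * Real.smoothTransition (θ - 1) := by
        have h := gompfLift_eq_of_mem_Ioc 1 2 hθ
        rw [gompfLift, show (θ - 1) / (2 - 1) = θ - 1 by ring] at h
        rw [sawArg]
        linarith
      rw [hs, show θ + -(θ - 2 * π * Real.smoothTransition (θ - 1)) =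
        2 * π * Real.smoothTransition (θ - 1) by ring]
  · -- `θ ≤ c`: the lift is `2π`, and `sawArg = θ`
    have hw : seamLift c (Circle.exp θ) = 2 * π := by
      have h := seamLift_exp (c := c) (θ := θ + 2 * π) (by linarith) (by linarith)
      rw [Circle.exp_add, Circle.exp_two_pi, mul_one] at h
      rw [h, Real.smoothTransition.one_of_one_le (by linarith), mul_one]
    rw [hw, sawArg_exp hθ.1 (by linarith), add_neg_cancel, Circle.exp_two_pi, Circle.exp_zero]

end Seam

/-! ### The step in the base direction and the far section -/

section Far

/-- **The base step** across `s ∈ (3/4 - δ, 3/4 + δ)`. [folklore] -/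
def sStep (δ s : ℝ) : ℝ := Real.smoothTransition ((s - (3 / 4 - δ)) / (2 * δ))

/-- The step is smooth. [folklore] -/
theorem contDiff_sStep (δ : ℝ) : ContDiff ℝ ∞ (sStep δ) :=
  Real.smoothTransition.contDiff.comp ((contDiff_id.sub contDiff_const).div_const _)

/-- Below `3/4 - δ` the step is `0`. [folklore] -/
theorem sStep_of_le {δ s : ℝ} (hδ : 0 < δ) (hs : s ≤ 3 / 4 - δ) : sStep δ s = 0 :=
  Real.smoothTransition.zero_of_nonpos (div_nonpos_of_nonpos_of_nonneg (by linarith) (by linarith))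

/-- Above `3/4 + δ` the step is `1`. [folklore] -/
theorem sStep_of_ge {δ s : ℝ} (hδ : 0 < δ) (hs : 3 / 4 + δ ≤ s) : sStep δ s = 1 :=
  Real.smoothTransition.one_of_one_le (by rw [le_div_iff₀ (by linarith)]; linarith)

/-- **The far section** `σ₀(z₁, s) = sStep(s) · G̃(z₁)` (real-valued; in the first cylinder it
vanishes near `s = 0⁺` and equals `G̃ ≡ G (mod 2π)` near `s = 1⁻`, which is the seam condition for
a section of the last-coordinate circle bundle of the mapping torus of `modelMonodromy` on the slab
`|y| ≤ 1`). [cite: GompfAGT2010, Thm 2.1 (proof: F intersects each torus fibre of ∂N in a circle)] -/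
def sigmaFar (c δ : ℝ) (z : Circle) (s : ℝ) : ℝ := sStep δ s * seamLift c z

/-- The far section as a point of the circle. [folklore] -/
def sigmaFarC (c δ : ℝ) (p : Circle × ℝ) : Circle := Circle.exp (sigmaFar c δ p.1 p.2)

/-- Below the step the far section is `0`. [folklore] -/
theorem sigmaFar_of_le {c δ : ℝ} {z : Circle} {s : ℝ} (hδ : 0 < δ) (hs : s ≤ 3 / 4 - δ) :
    sigmaFar c δ z s = 0 := by
  rw [sigmaFar, sStep_of_le hδ hs, zero_mul]

/-- Above the step the far section is the lift `G̃`. [folklore] -/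
theorem sigmaFar_of_ge {c δ : ℝ} {z : Circle} {s : ℝ} (hδ : 0 < δ) (hs : 3 / 4 + δ ≤ s) :
    sigmaFar c δ z s = seamLift c z := by
  rw [sigmaFar, sStep_of_ge hδ hs, one_mul]

/-- On the window and as a real function of `(θ, s)`, the far section is
`sStep(s) · 2π λ(θ - 1)`, a smooth function. [folklore] -/
theorem sigmaFar_exp {c δ θ s : ℝ} (h1 : c < θ) (h2 : θ ≤ c + 2 * π) :
    sigmaFar c δ (Circle.exp θ) s = sStep δ s * (2 * π * Real.smoothTransition (θ - 1)) := by
  rw [sigmaFar, seamLift_exp h1 h2]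

/-- **The far section is smooth off the slit** `{e^{ic}} × [3/4 - δ, 3/4 + δ]` as a
circle-valued map: off the cut point both factors are smooth; at the cut point with
`s < 3/4 - δ` it is locally `1`, with `s > 3/4 + δ` it is locally `e^{iG̃} = z₁ · shearFactor`,
smooth. [folklore] -/
theorem contMDiffAt_sigmaFarC {c δ : ℝ} (hc1 : -π < c) (hc2 : c < 1) (hδ : 0 < δ) {p : Circle × ℝ}
    (hp : (p.1 : ℂ) * exp (-((c + π : ℝ) : ℂ) * I) ∈ slitPlane ∨ p.2 < 3 / 4 - δ ∨ 3 / 4 + δ < p.2) :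
    ContMDiffAt ((𝓡 1).prod 𝓘(ℝ, ℝ)) (𝓡 1) ∞ (sigmaFarC c δ) p := by
  rcases hp with hz | hs | hs
  · have h1 : ContMDiffAt ((𝓡 1).prod 𝓘(ℝ, ℝ)) 𝓘(ℝ, ℝ) ∞ (fun q : Circle × ℝ ↦ sigmaFar c δ q.1 q.2) p :=
      ((contDiff_sStep δ).contDiffAt.comp_contMDiffAt contMDiffAt_snd).mul
        ((contMDiffAt_seamLift hz).comp p contMDiffAt_fst)
    exact contMDiff_circleExp.contMDiffAt.comp p h1
  · have hev : sigmaFarC c δ =ᶠ[𝓝 p] fun _ ↦ 1 := by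
      filter_upwards [(isOpen_lt continuous_snd continuous_const).mem_nhds hs] with q hq
      rw [sigmaFarC, sigmaFar_of_le hδ (le_of_lt hq), Circle.exp_zero]
    exact contMDiffAt_const.congr_of_eventuallyEq hev
  · have hev : sigmaFarC c δ =ᶠ[𝓝 p] fun q ↦ q.1 * shearFactor 1 q.1 1 := by
      filter_upwards [(isOpen_lt continuous_const continuous_snd).mem_nhds hs] with q hq
      rw [sigmaFarC, sigmaFar_of_ge hδ hq.le, circleExp_seamLift hc1 hc2]
    have h1 : ContMDiff ((𝓡 1).prod 𝓘(ℝ, ℝ)) (𝓡 1) ∞ fun q : Circle × ℝ ↦ q.1 * shearFactor 1 q.1 1 :=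
      contMDiff_fst.mul (contMDiff_shearFactor.comp
        (contMDiff_const.prodMk (contMDiff_fst.prodMk contMDiff_const)))
    exact h1.contMDiffAt.congr_of_eventuallyEq hev

end Far

/-! ### Near the puncture: the cut angle and the smooth correction -/

section Near

variable (tj δ : ℝ)

/-- **The puncture in the cap chart**: `d₀ = -i t_j` (`t_j = capRad ε (n_j)`, `s⋆ = 3/4`). [folklore] -/
def dCenter (tj : ℝ) : ℂ := -((tj : ℂ) * I)

/-- **The angle about the puncture with cut along the outward ray** `v ∈ -iℝ₊`:
`ϑ̂(v) = arg(-iv) + π/2`. [folklore] -/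
def thetaHat (v : ℂ) : ℝ := arg (-(I * v)) + π / 2

/-- **Outer indicator** `g₁ = [|d| > t_j]` (outside the arc through the puncture). [folklore] -/
def gOut (tj : ℝ) (d : ℂ) : ℝ := if tj < ‖d‖ then 1 else 0

/-- **Upper indicator** `g₂ = [re d > 0]` (`= [s(d) > 3/4]` in the lower half-plane). [folklore] -/
def gUp (d : ℂ) : ℝ := if 0 < d.re then 1 else 0

/-- The step read in the cap chart: `sStep (s(d))` with `s(d) = arg d / 2π + 1`. [folklore] -/
def sStepD (δ : ℝ) (d : ℂ) : ℝ := sStep δ (arg d / (2 * π) + 1)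

/-- **The smooth correction for a general step** `S` read in the chart:
`F_S = 2π g₁ (S - g₂) - ϑ̂(d - d₀)`. Each term jumps (across the arc, the ray `re d = 0`, the cut of
`ϑ̂`), but the jumps cancel off the slit of `S`. Used with `S = sStep ∘ s` (this file: the section
of the shear model) and with the model's seam step (`FishtailLambda.lean`). [folklore] -/
def seamCorrG (tj : ℝ) (S : ℂ → ℝ) (d : ℂ) : ℝ :=
  2 * π * gOut tj d * (S d - gUp d) - thetaHat (d - dCenter tj)

/-- **The smooth correction** `F = 2π g₁ (sStep - g₂) - ϑ̂(d - d₀)`. [folklore] -/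
def seamCorr (tj δ : ℝ) (d : ℂ) : ℝ := seamCorrG tj (sStepD δ) d

variable {tj δ}

/-- Unfolding `seamCorr`. [folklore] -/
theorem seamCorr_eq (tj δ : ℝ) (d : ℂ) :
    seamCorr tj δ d = 2 * π * gOut tj d * (sStepD δ d - gUp d) - thetaHat (d - dCenter tj) := rfl

/-- `-i(d - d₀) = (t_j - i d)`: real part `t_j + im d`, imaginary part `-re d`. [folklore] -/
theorem neg_I_mul_sub_dCenter (tj : ℝ) (d : ℂ) :
    -(I * (d - dCenter tj)) = ⟨tj + d.im, -d.re⟩ := by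
  apply Complex.ext <;> simp [dCenter]; ring

/-- `i(d - d₀)`: real part `-(t_j + im d)`, imaginary part `re d`. [folklore] -/
theorem I_mul_sub_dCenter (tj : ℝ) (d : ℂ) : I * (d - dCenter tj) = ⟨-(tj + d.im), d.re⟩ := by
  apply Complex.ext <;> simp [dCenter]; ring

/-- **`ϑ̂` is smooth off the cut ray**: at `d` with `re d ≠ 0` or `im d > -t_j`. [folklore] -/
theorem contDiffAt_thetaHat_sub {d : ℂ} (h : d.re ≠ 0 ∨ -tj < d.im) :
    ContDiffAt ℝ ∞ (fun d ↦ thetaHat (d - dCenter tj)) d := by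
  have hs : -(I * (d - dCenter tj)) ∈ slitPlane := by
    rw [neg_I_mul_sub_dCenter, mem_slitPlane_iff]
    rcases h with h | h
    · right; show -d.re ≠ 0; exact neg_ne_zero.2 h
    · left; show 0 < tj + d.im; linarith
  have h1 : ContDiff ℝ ∞ fun d : ℂ ↦ -(I * (d - dCenter tj)) := (contDiff_const.mul (contDiff_id.sub contDiff_const)).neg
  exact ((contDiffAt_arg hs).comp d h1.contDiffAt).add contDiffAt_const

/-- **`e^{iϑ̂(v)} = v/|v|`.** [folklore] -/
theorem exp_thetaHat_mul_I {v : ℂ} (hv : v ≠ 0) : exp (thetaHat v * I) = v / ‖v‖ := by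
  have h := norm_mul_exp_arg_mul_I (-(I * v))
  have hn : ‖-(I * v)‖ = ‖v‖ := by rw [norm_neg, norm_mul, Complex.norm_I, one_mul]
  have hv' : (‖v‖ : ℂ) ≠ 0 := by exact_mod_cast (norm_pos_iff.2 hv).ne'
  rw [hn] at h
  rw [thetaHat, Complex.ofReal_add, add_mul, Complex.exp_add,
    show ((π / 2 : ℝ) : ℂ) * I = (π / 2) * I by push_cast; ring, Complex.exp_pi_div_two_mul_I,
    eq_div_iff hv']
  linear_combination I * h - v * Complex.I_sq

/-- The key cancellation: for `im d < -t_j` (outside the arc, where `g₁ = 1` matters),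
`ϑ̂(d - d₀) + 2π g₂(d) = arg(i(d - d₀)) + 3π/2`, a smooth function there. [folklore] -/
theorem thetaHat_add_gUp {d : ℂ} (hd : d.im < -tj) :
    thetaHat (d - dCenter tj) + 2 * π * gUp d = arg (I * (d - dCenter tj)) + 3 * π / 2 := by
  have hneg : -(I * (d - dCenter tj)) = -(I * (d - dCenter tj)) := rfl
  rw [thetaHat, gUp]
  rcases lt_trichotomy 0 d.re with h | h | h
  · -- `re d > 0`: `im (i v) > 0`, `arg(-w) = arg w - π`
    have him : 0 < (I * (d - dCenter tj)).im := by rw [I_mul_sub_dCenter]; exact h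
    rw [if_pos h, arg_neg_eq_arg_sub_pi_of_im_pos him]
    ring
  · -- `re d = 0`: `i v = -(t_j + im d) > 0` real
    have hw : I * (d - dCenter tj) = ((-(tj + d.im) : ℝ) : ℂ) := by
      rw [I_mul_sub_dCenter, ← h]; rfl
    have hpos : 0 < -(tj + d.im) := by linarith
    rw [if_neg (by rw [← h]; exact lt_irrefl 0), hw, ← Complex.ofReal_neg, arg_ofReal_of_nonneg hpos.le,
      arg_ofReal_of_neg (by linarith)]
    ring
  · have him : (I * (d - dCenter tj)).im < 0 := by rw [I_mul_sub_dCenter]; exact h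
    rw [if_neg (not_lt.2 h.le), arg_neg_eq_arg_add_pi_of_im_neg him]
    ring

/-- **The general correction is smooth on the punctured region off the slit of `S`.**
Hypotheses: `d` in the open lower half-plane, `d ≠ d₀`, `S` smooth at `d`, and if `d` lies on the
arc `|d| = t_j` then near `d` the step agrees with the upper indicator (i.e. `d` is off the slit of
`S`). [folklore] -/
theorem contDiffAt_seamCorrG (htj : 0 < tj) {S : ℂ → ℝ} {d : ℂ} (him : d.im < 0)
    (hne : d ≠ dCenter tj) (hstep : ContDiffAt ℝ ∞ S d) (harc : ‖d‖ = tj → S =ᶠ[𝓝 d] gUp) :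
    ContDiffAt ℝ ∞ (seamCorrG tj S) d := by
  by_cases hn : ‖d‖ = tj
  · -- on the arc, off the slit: `F = -ϑ̂` near `d`
    have hev : seamCorrG tj S =ᶠ[𝓝 d] fun d' ↦ -thetaHat (d' - dCenter tj) := by
      filter_upwards [harc hn] with d' hd'
      rw [seamCorrG, hd', sub_self, mul_zero, zero_sub]
    refine ContDiffAt.congr_of_eventuallyEq ?_ hev
    refine (contDiffAt_thetaHat_sub ?_).neg
    -- `d` on the arc and `d ≠ d₀` ⇒ `re d ≠ 0` or `im d > -t_j`
    by_contra hcon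
    push Not at hcon
    apply hne
    have hre : d.re = 0 := hcon.1
    have h2 : d.im ^ 2 = tj ^ 2 := by
      have := Complex.sq_norm d
      rw [Complex.normSq_apply, hn, hre] at this
      nlinarith
    have h3 : d.im = -tj := by nlinarith [hcon.2]
    apply Complex.ext <;> simp [dCenter, hre, h3]
  · rcases lt_or_gt_of_ne hn with hlt | hgt
    · -- inside the arc: `g₁ = 0` near `d`, `F = -ϑ̂`, and `im d > -t_j`
      have hev : seamCorrG tj S =ᶠ[𝓝 d] fun d' ↦ -thetaHat (d' - dCenter tj) := by
        filter_upwards [(isOpen_lt continuous_norm continuous_const).mem_nhds hlt] with d' hd'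
        rw [seamCorrG, gOut, if_neg (not_lt.2 (le_of_lt hd')), mul_zero, zero_mul, zero_sub]
      refine ContDiffAt.congr_of_eventuallyEq ((contDiffAt_thetaHat_sub (Or.inr ?_)).neg) hev
      have := Complex.abs_im_le_norm d
      rw [abs_le] at this
      linarith [this.1]
    · -- outside the arc: `g₁ = 1` near `d`
      by_cases hre : d.re = 0
      · -- on the ray: use the cancellation `ϑ̂ + 2π g₂ = arg(i v) + 3π/2`
        have himt : d.im < -tj := by
          have h1 : ‖d‖ ^ 2 = d.im ^ 2 := by
            rw [Complex.sq_norm, Complex.normSq_apply, hre]; ring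
          nlinarith [norm_nonneg d]
        have hev : seamCorrG tj S =ᶠ[𝓝 d] fun d' ↦
            2 * π * S d' - (arg (I * (d' - dCenter tj)) + 3 * π / 2) := by
          filter_upwards [(isOpen_lt continuous_const continuous_norm).mem_nhds hgt,
            (isOpen_lt Complex.continuous_im continuous_const).mem_nhds himt] with d' h1 h2
          rw [seamCorrG, gOut, if_pos h1, ← thetaHat_add_gUp h2]
          ring
        refine ContDiffAt.congr_of_eventuallyEq ?_ hev
        have hpos : I * (d - dCenter tj) ∈ slitPlane := by
          rw [I_mul_sub_dCenter, mem_slitPlane_iff]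
          left; show 0 < -(tj + d.im); linarith
        have h1 : ContDiff ℝ ∞ fun d' : ℂ ↦ I * (d' - dCenter tj) :=
          contDiff_const.mul (contDiff_id.sub contDiff_const)
        exact (contDiffAt_const.mul hstep).sub
          (((contDiffAt_arg hpos).comp d h1.contDiffAt).add contDiffAt_const)
      · -- off the ray and off the arc: both indicators are locally constant
        have hev : seamCorrG tj S =ᶠ[𝓝 d] fun d' ↦
            2 * π * (S d' - gUp d) - thetaHat (d' - dCenter tj) := by
          have hU : ∀ᶠ d' in 𝓝 d, gUp d' = gUp d := by
            rcases lt_or_gt_of_ne hre with h | h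
            · filter_upwards [(isOpen_lt Complex.continuous_re continuous_const).mem_nhds h] with d' hd'
              rw [gUp, gUp, if_neg (not_lt.2 (le_of_lt hd')), if_neg (not_lt.2 h.le)]
            · filter_upwards [(isOpen_lt continuous_const Complex.continuous_re).mem_nhds h] with d' hd'
              rw [gUp, gUp, if_pos hd', if_pos h]
          filter_upwards [(isOpen_lt continuous_const continuous_norm).mem_nhds hgt, hU] with d' h1 h2
          rw [seamCorrG, gOut, if_pos h1, h2]
          ring
        refine ContDiffAt.congr_of_eventuallyEq ?_ hev
        exact (contDiffAt_const.mul (hstep.sub contDiffAt_const)).sub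
          (contDiffAt_thetaHat_sub (Or.inl hre))

/-- **The correction is smooth on the punctured region off the slit**
`{|d| = t_j, s(d) ∈ [3/4 - δ, 3/4 + δ]}`. [folklore] -/
theorem contDiffAt_seamCorr (htj : 0 < tj) {d : ℂ} (him : d.im < 0) (hne : d ≠ dCenter tj)
    (harc : ‖d‖ = tj → (fun d' ↦ sStepD δ d') =ᶠ[𝓝 d] gUp) :
    ContDiffAt ℝ ∞ (seamCorr tj δ) d :=
  contDiffAt_seamCorrG htj him hne ((contDiff_sStep δ).contDiffAt.comp d
    (((contDiffAt_arg (Or.inr him.ne)).div_const _).add contDiffAt_const)) harc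

/-- **Exponentiating the general correction**: `e^{iF_S} · (v/|v|) = e^{2πi g₁ S}`
(`v = d - d₀ ≠ 0`), because `g₁ g₂ ∈ {0, 1}`. [folklore] -/
theorem exp_seamCorrG_mul_I (S : ℂ → ℝ) {d : ℂ} (hd : d ≠ dCenter tj) :
    exp (seamCorrG tj S d * I) * ((d - dCenter tj) / ‖d - dCenter tj‖) =
      exp ((2 * π * gOut tj d * S d : ℝ) * I) := by
  have hv : d - dCenter tj ≠ 0 := sub_ne_zero.2 hd
  rw [← exp_thetaHat_mul_I hv, ← Complex.exp_add, seamCorrG]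
  have hk : ∃ k : ℤ, gOut tj d * gUp d = k := by
    unfold gOut gUp
    split_ifs
    exacts [⟨1, by norm_num⟩, ⟨0, by norm_num⟩, ⟨0, by norm_num⟩, ⟨0, by norm_num⟩]
  obtain ⟨k, hk⟩ := hk
  have : ((2 * π * gOut tj d * (S d - gUp d) - thetaHat (d - dCenter tj) : ℝ) : ℂ) * I +
      thetaHat (d - dCenter tj) * I =
      ((2 * π * gOut tj d * S d : ℝ) : ℂ) * I + ((-k : ℤ) : ℂ) * (2 * π * I) := by
    have hk' : (gOut tj d : ℂ) * (gUp d : ℂ) = k := by exact_mod_cast hk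
    push_cast
    linear_combination (-(2 * π * I)) * hk'
  rw [this, Complex.exp_add, Complex.exp_int_mul_two_pi_mul_I, mul_one]

/-- **Exponentiating the correction**: `e^{iF} · (v/|v|) = e^{2πi g₁ sStep}` (`v = d - d₀ ≠ 0`).
Hence `ϑ̂ + F ≡ σ₀ (mod 2π)` where `σ₀ = 2π g₁ sStep` is the far section read in the chart. [folklore] -/
theorem exp_seamCorr_mul_I {d : ℂ} (hd : d ≠ dCenter tj) :
    exp (seamCorr tj δ d * I) * ((d - dCenter tj) / ‖d - dCenter tj‖) =
      exp ((2 * π * gOut tj d * sStepD δ d : ℝ) * I) :=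
  exp_seamCorrG_mul_I (sStepD δ) hd

end Near

/-! ### The circle-valued section on the cap disc -/

section CapDisc

/-- **The unit vector as a point of the circle** (`1` at the origin). [folklore] -/
def unitC (v : ℂ) : Circle := Circle.exp (arg v)

/-- `unitC v = v / |v|` for `v ≠ 0`. [folklore] -/
theorem coe_unitC {v : ℂ} (hv : v ≠ 0) : (unitC v : ℂ) = v / ‖v‖ := by
  have h := norm_mul_exp_arg_mul_I v
  have hv' : (‖v‖ : ℂ) ≠ 0 := by exact_mod_cast (norm_pos_iff.2 hv).ne'
  rw [unitC, Circle.coe_exp, eq_div_iff hv', mul_comm]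
  exact h

/-- The other branch: `unitC v = e^{i(arg(-v) + π)}` (`v ≠ 0`). [folklore] -/
theorem unitC_eq_exp_arg_neg {v : ℂ} (hv : v ≠ 0) : unitC v = Circle.exp (arg (-v) + π) := by
  apply Subtype.ext
  have hv' : (‖v‖ : ℂ) ≠ 0 := by exact_mod_cast (norm_pos_iff.2 hv).ne'
  have h := norm_mul_exp_arg_mul_I (-v)
  rw [norm_neg] at h
  have h2 : exp ((arg (-v) : ℂ) * I) = -v / ‖v‖ := by rw [eq_div_iff hv', mul_comm]; exact h
  rw [coe_unitC hv, Circle.coe_exp, Complex.ofReal_add, add_mul, Complex.exp_add, h2,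
    Complex.exp_pi_mul_I]
  ring

/-- **`unitC` is smooth off the origin** (one of the two branches of the argument is smooth). [folklore] -/
theorem contMDiffAt_unitC {v : ℂ} (hv : v ≠ 0) : ContMDiffAt 𝓘(ℝ, ℂ) (𝓡 1) ∞ unitC v := by
  by_cases hs : v ∈ slitPlane
  · exact contMDiff_circleExp.contMDiffAt.comp v (contDiffAt_arg hs).contMDiffAt
  · have hs' : -v ∈ slitPlane := by
      rw [mem_slitPlane_iff, not_or, not_lt, not_not] at hs
      rw [mem_slitPlane_iff, neg_re, neg_im, hs.2, neg_zero]
      left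
      rcases hs.1.lt_or_eq with h | h
      · linarith
      · exact absurd (Complex.ext h hs.2) hv
    have hev : unitC =ᶠ[𝓝 v] fun w ↦ Circle.exp (arg (-w) + π) := by
      filter_upwards [isOpen_ne.mem_nhds hv] with w hw
      exact unitC_eq_exp_arg_neg hw
    refine ContMDiffAt.congr_of_eventuallyEq ?_ hev
    have h1 : ContDiffAt ℝ ∞ (fun w : ℂ ↦ arg (-w) + π) v :=
      ((contDiffAt_arg hs').comp v contDiff_neg.contDiffAt).add contDiffAt_const
    exact contMDiff_circleExp.contMDiffAt.comp v h1.contMDiffAt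

variable (tj δ : ℝ)

/-- **The far section read on the cap disc** as a point of the circle:
`E(d) = e^{2πi g₁(d) sStep(s(d))}`. [folklore] -/
def sigmaOutC (tj δ : ℝ) (d : ℂ) : Circle := Circle.exp (2 * π * gOut tj d * sStepD δ d)

variable {tj δ}

/-- Where the step is `1` the far section is `1` (`e^{2πi g₁} = 1`). [folklore] -/
theorem sigmaOutC_eq_one_of_sStepD_eq_one {d : ℂ} (h : sStepD δ d = 1) : sigmaOutC tj δ d = 1 := by
  rw [sigmaOutC, h, mul_one, gOut]
  split_ifs
  · rw [mul_one, Circle.exp_two_pi]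
  · rw [mul_zero, Circle.exp_zero]

/-- Where the step is `0` the far section is `1`. [folklore] -/
theorem sigmaOutC_eq_one_of_sStepD_eq_zero {d : ℂ} (h : sStepD δ d = 0) : sigmaOutC tj δ d = 1 := by
  rw [sigmaOutC, h, mul_zero, Circle.exp_zero]

/-- Inside the arc (`|d| ≤ t_j`) the far section is `1`. [folklore] -/
theorem sigmaOutC_eq_one_of_norm_le {d : ℂ} (h : ‖d‖ ≤ tj) : sigmaOutC tj δ d = 1 := by
  rw [sigmaOutC, gOut, if_neg (not_lt.2 h), mul_zero, zero_mul, Circle.exp_zero]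

/-- **In the slit directions the point is deep in the lower half-plane**: if
`s(d) ∈ (3/4 - δ, 3/4 + δ)` (`δ ≤ 1/4`) then `im d ≤ -|d| cos(2πδ)`. [folklore] -/
theorem im_le_of_sStep_window (hδ' : δ ≤ 1 / 4) {d : ℂ}
    (h1 : 3 / 4 - δ < arg d / (2 * π) + 1) (h2 : arg d / (2 * π) + 1 < 3 / 4 + δ) :
    d.im ≤ -(‖d‖ * Real.cos (2 * π * δ)) := by
  have hπ := Real.pi_pos
  have ha1 : -(π / 2) - 2 * π * δ < arg d := by
    have := (lt_div_iff₀ (by positivity : (0:ℝ) < 2 * π)).1 (show (-(1:ℝ) / 4 - δ) < arg d / (2 * π) by linarith)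
    linarith
  have ha2 : arg d < -(π / 2) + 2 * π * δ := by
    have := (div_lt_iff₀ (by positivity : (0:ℝ) < 2 * π)).1 (show arg d / (2 * π) < -(1:ℝ) / 4 + δ by linarith)
    linarith
  -- `sin (arg d) = -cos (arg d + π/2) ≤ -cos (2πδ)`
  have hcos : Real.cos (2 * π * δ) ≤ Real.cos (arg d + π / 2) := by
    rw [← Real.cos_abs (arg d + π / 2)]
    exact Real.cos_le_cos_of_nonneg_of_le_pi (abs_nonneg _) (by nlinarith)
      (abs_le.2 ⟨by linarith, by linarith⟩)
  have hsin : Real.sin (arg d) = -Real.cos (arg d + π / 2) := by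
    rw [Real.cos_add_pi_div_two, neg_neg]
  have him : d.im = ‖d‖ * Real.sin (arg d) := by
    rcases eq_or_ne d 0 with rfl | hd
    · simp
    · rw [Complex.sin_arg, mul_div_cancel₀ _ (norm_ne_zero_iff.2 hd)]
  rw [him, hsin]
  nlinarith [norm_nonneg d]

/-- **Above the level `im = -t_j cos(2πδ)` the far section is `1`**: inside the arc `g₁ = 0`,
outside it the step is saturated (the slit directions force `im d ≤ -|d| cos 2πδ < -t_j cos 2πδ`). [folklore] -/
theorem sigmaOutC_eq_one_of_im_gt (hδ : 0 < δ) (hδ' : δ ≤ 1 / 4) {d : ℂ}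
    (h : -(tj * Real.cos (2 * π * δ)) < d.im) : sigmaOutC tj δ d = 1 := by
  rcases le_or_gt ‖d‖ tj with hn | hn
  · exact sigmaOutC_eq_one_of_norm_le hn
  · rcases le_or_gt (arg d / (2 * π) + 1) (3 / 4 - δ) with h1 | h1
    · exact sigmaOutC_eq_one_of_sStepD_eq_zero (sStep_of_le hδ h1)
    · rcases le_or_gt (3 / 4 + δ) (arg d / (2 * π) + 1) with h2 | h2
      · exact sigmaOutC_eq_one_of_sStepD_eq_one (sStep_of_ge hδ h2)
      · exfalso
        have hle := im_le_of_sStep_window hδ' h1 h2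
        have hc : 0 ≤ Real.cos (2 * π * δ) := Real.cos_nonneg_of_mem_Icc
          ⟨by nlinarith [Real.pi_pos], by nlinarith [Real.pi_pos]⟩
        nlinarith

/-- **The far section is smooth on the cap disc off the slit.** Two open sets cover the
complement of the slit: the region `im d > -t_j cos 2πδ`, where the section is locally `1`, and
the open lower half-plane, where the argument is smooth, `g₁` is locally constant off the arc and
on the arc (off the slit, hypothesis `hd`) the step is saturated near `d`. [folklore] -/
theorem contMDiffAt_sigmaOutC (htj : 0 < tj) (hδ : 0 < δ) (hδ' : δ < 1 / 4) {d : ℂ}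
    (hd : ‖d‖ = tj → d.im < 0 →
      3 / 4 + δ < arg d / (2 * π) + 1 ∨ arg d / (2 * π) + 1 < 3 / 4 - δ) :
    ContMDiffAt 𝓘(ℝ, ℂ) (𝓡 1) ∞ (sigmaOutC tj δ) d := by
  by_cases hup : -(tj * Real.cos (2 * π * δ)) < d.im
  · have hev : sigmaOutC tj δ =ᶠ[𝓝 d] fun _ ↦ 1 := by
      filter_upwards [(isOpen_lt continuous_const Complex.continuous_im).mem_nhds hup] with d' hd'
      exact sigmaOutC_eq_one_of_im_gt hδ hδ'.le hd'
    exact contMDiffAt_const.congr_of_eventuallyEq hev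
  · have hc : 0 < Real.cos (2 * π * δ) := Real.cos_pos_of_mem_Ioo
      ⟨by nlinarith [Real.pi_pos], by nlinarith [Real.pi_pos]⟩
    have him : d.im < 0 := by nlinarith [not_lt.1 hup]
    have hslit : d ∈ slitPlane := Or.inr him.ne
    have hS : ContDiffAt ℝ ∞ (sStepD δ) d :=
      (contDiff_sStep δ).contDiffAt.comp d (((contDiffAt_arg hslit).div_const _).add contDiffAt_const)
    by_cases hn : ‖d‖ = tj
    · have hca : ContinuousAt (fun d : ℂ ↦ arg d / (2 * π) + 1) d :=
        ((continuousAt_arg hslit).div_const _).add continuousAt_const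
      have hev : sigmaOutC tj δ =ᶠ[𝓝 d] fun _ ↦ 1 := by
        rcases hd hn him with h | h
        · filter_upwards [hca.eventually (isOpen_lt continuous_const continuous_id |>.mem_nhds h)]
            with d' hd'
          exact sigmaOutC_eq_one_of_sStepD_eq_one (sStep_of_ge hδ (le_of_lt hd'))
        · filter_upwards [hca.eventually (isOpen_lt continuous_id continuous_const |>.mem_nhds h)]
            with d' hd'
          exact sigmaOutC_eq_one_of_sStepD_eq_zero (sStep_of_le hδ (le_of_lt hd'))
      exact contMDiffAt_const.congr_of_eventuallyEq hev
    · have hev : sigmaOutC tj δ =ᶠ[𝓝 d] fun d' ↦ Circle.exp (2 * π * gOut tj d * sStepD δ d') := by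
        rcases lt_or_gt_of_ne hn with h | h
        · filter_upwards [(isOpen_lt continuous_norm continuous_const).mem_nhds h] with d' hd'
          rw [sigmaOutC, gOut, gOut, if_neg (not_lt.2 hd'.le), if_neg (not_lt.2 h.le)]
        · filter_upwards [(isOpen_lt continuous_const continuous_norm).mem_nhds h] with d' hd'
          rw [sigmaOutC, gOut, gOut, if_pos hd', if_pos h]
      refine ContMDiffAt.congr_of_eventuallyEq ?_ hev
      exact contMDiff_circleExp.contMDiffAt.comp d (contDiffAt_const.mul hS).contMDiffAt

variable (tj δ) (r₁ r₂ r₃ : ℝ)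

/-- **The radial blend** `β(ρ) = λ((ρ - r₁)/(r₂ - r₁))`: `0` for `ρ ≤ r₁`, `1` for `ρ ≥ r₂`. [folklore] -/
def capBlend (r₁ r₂ ρ : ℝ) : ℝ := Real.smoothTransition ((ρ - r₁) / (r₂ - r₁))

/-- **The section on the cap disc** (circle-valued): within distance `r₃` of the puncture it is
`(v/|v|) · e^{iβ(|v|) F}` (`v = d - d₀`) — the polar angle about the puncture blended into the far
section —, beyond it is the far section `E`. [cite: GompfAGT2010, Thm 2.1 (proof: F′ = F with a disc about C removed; here F′ is the graph of this section off the puncture)] -/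
def sigmaCapC (d : ℂ) : Circle :=
  if ‖d - dCenter tj‖ < r₃ then
    unitC (d - dCenter tj) * Circle.exp (capBlend r₁ r₂ ‖d - dCenter tj‖ * seamCorr tj δ d)
  else sigmaOutC tj δ d

variable {tj δ r₁ r₂ r₃}

/-- On the blended region with `β = 1` the two formulas agree:
`(v/|v|) e^{iF} = E`. [folklore] -/
theorem unitC_mul_exp_seamCorr {d : ℂ} (hd : d ≠ dCenter tj) :
    unitC (d - dCenter tj) * Circle.exp (seamCorr tj δ d) = sigmaOutC tj δ d := by
  apply Subtype.ext
  rw [Circle.coe_mul, coe_unitC (sub_ne_zero.2 hd), Circle.coe_exp, sigmaOutC, Circle.coe_exp, mul_comm]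
  exact exp_seamCorr_mul_I hd

/-- **Near the puncture the section is the polar angle**: for `|d - d₀| ≤ r₁` (`< r₃`),
`σ = v/|v|`. [folklore] -/
theorem sigmaCapC_of_norm_le (h12 : r₁ < r₂) (h13 : r₁ < r₃) {d : ℂ} (h : ‖d - dCenter tj‖ ≤ r₁) :
    sigmaCapC tj δ r₁ r₂ r₃ d = unitC (d - dCenter tj) := by
  rw [sigmaCapC, if_pos (lt_of_le_of_lt h h13), capBlend,
    Real.smoothTransition.zero_of_nonpos (div_nonpos_of_nonpos_of_nonneg (by linarith) (by linarith)),
    zero_mul, Circle.exp_zero, mul_one]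

/-- **Away from the puncture the section is the far section**: for `|d - d₀| ≥ r₂`. [folklore] -/
theorem sigmaCapC_of_le_norm (h1 : 0 < r₁) (h12 : r₁ < r₂) {d : ℂ} (h : r₂ ≤ ‖d - dCenter tj‖) :
    sigmaCapC tj δ r₁ r₂ r₃ d = sigmaOutC tj δ d := by
  rw [sigmaCapC]
  split_ifs with h3
  · have hd : d ≠ dCenter tj := by
      rintro rfl; rw [sub_self, norm_zero] at h; linarith
    rw [capBlend, Real.smoothTransition.one_of_one_le ((one_le_div (by linarith)).2 (by linarith)),
      one_mul, unitC_mul_exp_seamCorr hd]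
  · rfl

/-- **The section on the cap disc is smooth off the puncture.** Hypotheses: `0 < r₁ < r₂ < r₃`;
the correction `F` is smooth on the closed annulus `r₁ ≤ |d - d₀| ≤ r₃` (which holds when that
annulus lies in the lower half-plane off the slit, `contDiffAt_seamCorr`); the far section is
smooth where `|d - d₀| ≥ r₂` (`contMDiffAt_sigmaOutC`). [folklore] -/
theorem contMDiffAt_sigmaCapC (h1 : 0 < r₁) (h12 : r₁ < r₂) (h23 : r₂ < r₃) {d : ℂ}
    (hd : d ≠ dCenter tj)
    (hF : ∀ d', r₁ ≤ ‖d' - dCenter tj‖ → ‖d' - dCenter tj‖ ≤ r₃ → ContDiffAt ℝ ∞ (seamCorr tj δ) d')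
    (hE : ∀ d', r₂ ≤ ‖d' - dCenter tj‖ → ContMDiffAt 𝓘(ℝ, ℂ) (𝓡 1) ∞ (sigmaOutC tj δ) d') :
    ContMDiffAt 𝓘(ℝ, ℂ) (𝓡 1) ∞ (sigmaCapC tj δ r₁ r₂ r₃) d := by
  have hcn : Continuous fun d : ℂ ↦ ‖d - dCenter tj‖ := by fun_prop
  rcases lt_or_ge ‖d - dCenter tj‖ r₃ with h3 | h3
  · -- the blended formula near `d`
    have hev : sigmaCapC tj δ r₁ r₂ r₃ =ᶠ[𝓝 d] fun d' ↦
        unitC (d' - dCenter tj) * Circle.exp (capBlend r₁ r₂ ‖d' - dCenter tj‖ * seamCorr tj δ d') := by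
      filter_upwards [(isOpen_lt hcn continuous_const).mem_nhds h3] with d' hd'
      rw [sigmaCapC, if_pos hd']
    refine ContMDiffAt.congr_of_eventuallyEq ?_ hev
    have hsub : ContMDiffAt 𝓘(ℝ, ℂ) 𝓘(ℝ, ℂ) ∞ (fun d' : ℂ ↦ d' - dCenter tj) d :=
      ((contDiff_id (𝕜 := ℝ) (E := ℂ)).sub contDiff_const).contDiffAt.contMDiffAt
    have hu : ContMDiffAt 𝓘(ℝ, ℂ) (𝓡 1) ∞ (fun d' ↦ unitC (d' - dCenter tj)) d :=
      ContMDiffAt.comp (g := unitC) (f := fun d' : ℂ ↦ d' - dCenter tj) d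
        (contMDiffAt_unitC (sub_ne_zero.2 hd)) hsub
    refine hu.mul (contMDiff_circleExp.contMDiffAt.comp d (ContDiffAt.contMDiffAt ?_))
    -- smoothness of `β(|v|) F`: near `|v| < r₁` it vanishes identically, elsewhere both are smooth
    rcases lt_or_ge ‖d - dCenter tj‖ r₁ with h0 | h0
    · have hev' : (fun d' ↦ capBlend r₁ r₂ ‖d' - dCenter tj‖ * seamCorr tj δ d') =ᶠ[𝓝 d] fun _ ↦ 0 := by
        filter_upwards [(isOpen_lt hcn continuous_const).mem_nhds h0] with d' hd'
        rw [capBlend, Real.smoothTransition.zero_of_nonpos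
          (div_nonpos_of_nonpos_of_nonneg (by linarith) (by linarith)), zero_mul]
      exact contDiffAt_const.congr_of_eventuallyEq hev'
    · have hb : ContDiffAt ℝ ∞ (fun d' ↦ capBlend r₁ r₂ ‖d' - dCenter tj‖) d :=
        (Real.smoothTransition.contDiff.comp ((contDiff_id.sub contDiff_const).div_const _)).contDiffAt.comp
          d (contDiffAt_norm ℝ (sub_ne_zero.2 hd) |>.comp d (contDiff_id.sub contDiff_const).contDiffAt)
      exact hb.mul (hF d h0 h3.le)
  · -- the far formula near `d` (both formulas agree on `r₂ ≤ |v|`)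
    have hev : sigmaCapC tj δ r₁ r₂ r₃ =ᶠ[𝓝 d] sigmaOutC tj δ := by
      filter_upwards [(isOpen_lt continuous_const hcn).mem_nhds (lt_of_lt_of_le h23 h3)] with d' hd'
      exact sigmaCapC_of_le_norm h1 h12 hd'.le
    exact (hE d (h23.le.trans h3)).congr_of_eventuallyEq hev

end CapDisc

end Literature.Topology.FourManifolds
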